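import Summits.Ventures.LatticeQCDFlow.Scaling.SwapLadderIndexTauIntCritGap
import Summits.Ventures.LatticeQCDFlow.Scaling.SwapLadderIndexTauIntClosedSimplex

/-!
HONEST FRAMING: exact (Metropolis-corrected) sampling algorithms for lattice gauge theory; figures
of merit are autocorrelation/cost numbers at stated couplings and volumes; no continuum-physics
claim.

# SwapLadderIndexTauIntThreshold — THE COLLAPSE THRESHOLD OF THE `τ_int`-OPTIMAL SWAP LADDER: A POSITIVE INDEX-OPTIMAL
# GAP VECTOR OF TOTAL STIFFNESS `Λ` EXISTS IFF `Λ > Λ_c(K) = Σ_{j<K} critGap((w_max/w_j)²)`; AT OR BELOW `Λ_c(K)` EVERY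
# CLOSED-SIMPLEX MINIMISER HAS A ZERO GAP (row 22 `su3-ptbc`, GEN-8, ours; part 3 of 3 — sequel of
# `SwapLadderIndexTauIntCritGap` and `SwapLadderIndexTauIntClosedSimplex`)

Venture `LatticeQCDFlow` (cell pub-lqcd), topic `Scaling`; FANOUT row 22 (`su3-ptbc`).  NEW WORK of the cell over
`SwapLadderIndexTauIntCritGap` (`critGap`, `deriv_le_iff_le_critGap`, `lt_deriv_iff_critGap_lt`, `maxPassageWeight`,
`passageWeight_le_max`, `one_le_weightRatio_sq`, `thresholdStiffness` =: `Λ_c(K)`), `SwapLadderIndexTauIntClosedSimplex`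
(`closedGapSimplex`, `finIndexCost`, `exists_isMinOn_closedGapSimplex`, `isMinOn_gapSimplex_of_closed`,
`weight_sq_mul_deriv_le_of_isMinOn_closed`) and GEN-7's `SwapLadderIndexTauIntOptimumShape` (`gapSimplex`, `gapIndexCost`,
`weight_sq_mul_deriv_zero_lt`).  Nothing is cited as a fact; no `native_decide`.

THE POINT (model statements; `K ≥ 1` gaps, passage weights `w_j = (j+1)(K−j)`, `G = 1/erfc(·/(2√2))`).
`SwapLadderIndexTauIntOptimumShape` describes every POSITIVE minimiser of the replica-index cost `Σ_j w_j²·G(ℓ_j)` at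
fixed total stiffness `Λ = Σ_j ℓ_j` (mirror-symmetric, middle-tight, never uniform for `K ≥ 3`) and warns that for small
`Λ` none exists; the staged `SwapLadderIndexTauIntOptimumUnique` adds sufficiency of stationarity and uniqueness.  This
file settles EXISTENCE exactly:

* **`le_thresholdStiffness_of_zero_gap`** — a closed-simplex minimiser with a zero gap `j` forces `Λ ≤ Λ_c(K)`: by the
  one-sided Fermat condition every positive gap `i` has `w_i²·G′(v_i) ≤ w_j²·G′(0) ≤ w_max²·G′(0)`, i.e.
  `v_i ≤ critGap((w_max/w_i)²)`; sum over `i`.  Hence **for `Λ > Λ_c(K)` every closed-simplex minimiser is positive**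
  (`pos_of_isMinOn_closed`) and **a positive index-optimal gap vector EXISTS** (`exists_isMinOn_gapSimplex`).
* **`thresholdStiffness_lt_of_isMinOn`** — conversely a positive optimum is stationary with common value
  `w_max²·G′(ℓ_mid) > w_max²·G′(0)` (`ℓ_mid > 0`), so `G′(ℓ_j) > (w_max/w_j)²·G′(0)`, i.e. `ℓ_j > critGap((w_max/w_j)²)`,
  for every `j`, and `Λ > Λ_c(K)`.
* **`exists_isMinOn_gapSimplex_iff`** — THE THRESHOLD THEOREM: `(∃ positive index-optimal ℓ with Σℓ = Λ) ↔ Λ_c(K) < Λ`.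
  For `K ≤ 2`, `Λ_c = 0`: every `Λ > 0` qualifies (the optimum is then the uniform ladder —
  `SwapLadderIndexTauIntTuning.indexCost_two`); for `K ≥ 3`, `Λ_c(K) > 0` and **for `0 ≤ Λ ≤ Λ_c(K)` every
  closed-simplex minimiser HAS A ZERO GAP** (`exists_gap_eq_zero_of_le_thresholdStiffness`,
  `exists_gap_eq_zero_at_thresholdStiffness`) — the collapse of the parent's header, quantified: optimising the model
  index `τ_int` on too small a stiffness budget merges replicas.

Reading for the card (value-free; desk numerics of GEN-7, NOT certified: `Λ_c(12) ≈ 10.9` against `Λ ≈ 30.8` for the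
flat-`20 %` S2 ladder, `K = 12`): at the card's points the model's `τ_int`-optimal ladder is interior, hence exists, is
unique (staged sequel) and has the shape of `SwapLadderIndexTauIntOptimumShape`; GEN-7's `−19 %` index-`τ_int` /
`+43 %` round-trip trade-off therefore refers to a genuine optimum, not an infimum.  NOT CLAIMED: a closed form for the
optimum or for `Λ_c(K)` (bounds: `…ThresholdCard`, `…ThresholdAllK`, `…ThresholdCollapse`; uniqueness and shape on the closed
simplex: `…CollapsePattern`), anything about PTBC itself or a run.
-/

noncomputable section

open Finset Real Filter Topology

namespace Summit.Ventures.LatticeQCDFlow.Scaling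

/-! ## The threshold theorem -/

section Main

variable {K : ℕ} {Λ : ℝ}

/-- **A CLOSED-SIMPLEX MINIMISER WITH A ZERO GAP FORCES `Λ ≤ Λ_c(K)`**: against the zero gap `j`, every positive
gap `i` has `w_i²·G′(v_i) ≤ w_j²·G′(0) ≤ w_max²·G′(0)`, i.e. `v_i ≤ critGap((w_max/w_i)²)`; sum over `i`. [ours] -/
theorem le_thresholdStiffness_of_zero_gap {v : Fin K → ℝ} (hv : v ∈ closedGapSimplex K Λ)
    (hmin : IsMinOn (finIndexCost K) (closedGapSimplex K Λ) v) {j : Fin K} (hj : v j = 0) :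
    Λ ≤ thresholdStiffness K := by
  have key : ∀ i : Fin K, v i ≤ critGap ((maxPassageWeight K / passageWeight K i) ^ 2) := by
    intro i
    rcases (hv.1 i).eq_or_lt with h0 | hpos
    · rw [← h0]; exact critGap_nonneg _
    · have hR := one_le_weightRatio_sq (K := K) i.isLt
      rw [← deriv_le_iff_le_critGap hR (v i)]
      have h := weight_sq_mul_deriv_le_of_isMinOn_closed hv hmin hpos j
      rw [hj] at h
      have hwj : passageWeight K j ^ 2 ≤ maxPassageWeight K ^ 2 :=
        pow_le_pow_left₀ (passageWeight_pos j.isLt).le (passageWeight_le_max j.isLt) 2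
      have hd0 := deriv_gaussInvAcc_pos 0
      have hwi := passageWeight_pos (K := K) i.isLt
      rw [div_pow, div_mul_eq_mul_div, le_div_iff₀ (pow_pos hwi 2)]
      nlinarith
  calc Λ = ∑ i : Fin K, v i := hv.2.symm
    _ ≤ ∑ i : Fin K, critGap ((maxPassageWeight K / passageWeight K i) ^ 2) := sum_le_sum fun i _ => key i
    _ = thresholdStiffness K :=
      Fin.sum_univ_eq_sum_range (fun j => critGap ((maxPassageWeight K / passageWeight K j) ^ 2)) K

/-- Hence **for `Λ > Λ_c(K)` every closed-simplex minimiser is POSITIVE.** [ours] -/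
theorem pos_of_isMinOn_closed (hΛ : thresholdStiffness K < Λ) {v : Fin K → ℝ} (hv : v ∈ closedGapSimplex K Λ)
    (hmin : IsMinOn (finIndexCost K) (closedGapSimplex K Λ) v) (i : Fin K) : 0 < v i := by
  by_contra h
  have h0 : v i = 0 := le_antisymm (not_lt.1 h) (hv.1 i)
  exact absurd (le_thresholdStiffness_of_zero_gap hv hmin h0) (not_le.2 hΛ)

/-- **EXISTENCE: for `K ≥ 1` and `Λ > Λ_c(K)` a positive index-optimal gap vector of total stiffness `Λ` EXISTS**
(and is then mirror-symmetric, middle-tight — `SwapLadderIndexTauIntOptimumShape` — and unique — the staged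
`SwapLadderIndexTauIntOptimumUnique`). [ours] -/
theorem exists_isMinOn_gapSimplex (hK : 0 < K) (hΛ : thresholdStiffness K < Λ) :
    ∃ ℓ ∈ gapSimplex K Λ, IsMinOn (gapIndexCost K) (gapSimplex K Λ) ℓ := by
  have hΛ0 : 0 ≤ Λ := (thresholdStiffness_nonneg K).trans hΛ.le
  obtain ⟨v, hv, hmin⟩ := exists_isMinOn_closedGapSimplex hK hΛ0
  have h := isMinOn_gapSimplex_of_closed hv hmin (pos_of_isMinOn_closed hΛ hv hmin)
  exact ⟨extendGaps K v, h.1, h.2⟩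

/-- **NECESSITY: a positive index-optimal gap vector has `Λ > Λ_c(K)`** — stationarity gives the common value
`μ = w_max²·G′(ℓ_mid) > w_max²·G′(0)`, so `G′(ℓ_j) > (w_max/w_j)²·G′(0)`, i.e. `ℓ_j > critGap((w_max/w_j)²)`, for every
`j < K`; sum. [ours] -/
theorem thresholdStiffness_lt_of_isMinOn {ℓ : ℕ → ℝ} (hℓ : ℓ ∈ gapSimplex K Λ)
    (hmin : IsMinOn (gapIndexCost K) (gapSimplex K Λ) ℓ) (hK : 0 < K) : thresholdStiffness K < Λ := by
  have hm : (K - 1) / 2 < K := middle_lt hK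
  have key : ∀ j ∈ range K, critGap ((maxPassageWeight K / passageWeight K j) ^ 2) < ℓ j := by
    intro j hj
    have hjK := mem_range.1 hj
    have hR := one_le_weightRatio_sq hjK
    rw [← lt_deriv_iff_critGap_lt hR (ℓ j)]
    have h := weight_sq_mul_deriv_zero_lt hℓ hmin hm hjK
    have hwj := passageWeight_pos hjK
    rw [div_pow, div_mul_eq_mul_div, div_lt_iff₀ (pow_pos hwj 2)]
    rw [maxPassageWeight_eq]
    linarith
  calc thresholdStiffness K
      < ∑ j ∈ range K, ℓ j := sum_lt_sum_of_nonempty ⟨0, mem_range.2 hK⟩ key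
    _ = Λ := hℓ.2

/-- **THE THRESHOLD THEOREM (`K ≥ 1`): a positive index-optimal gap vector of total stiffness `Λ` exists iff
`Λ_c(K) < Λ`.** [ours] -/
theorem exists_isMinOn_gapSimplex_iff (hK : 0 < K) :
    (∃ ℓ ∈ gapSimplex K Λ, IsMinOn (gapIndexCost K) (gapSimplex K Λ) ℓ) ↔ thresholdStiffness K < Λ :=
  ⟨fun ⟨_, hℓ, hmin⟩ => thresholdStiffness_lt_of_isMinOn hℓ hmin hK, exists_isMinOn_gapSimplex hK⟩

/-- THE DRIVER'S DEO SCHEME HAS THE SAME THRESHOLD: its index functional `Σ_j w_j²·(G(ℓ_j) − 1)` has the same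
minimisers (`isMinOn_deo_iff`), so a positive DEO-index-optimal gap vector exists iff `Λ_c(K) < Λ`. [ours] -/
theorem exists_isMinOn_deo_gapSimplex_iff (hK : 0 < K) :
    (∃ ℓ ∈ gapSimplex K Λ,
        IsMinOn (fun ℓ' : ℕ → ℝ => ∑ j ∈ range K, passageWeight K j ^ 2 * (gaussInvAcc (ℓ' j) - 1)) (gapSimplex K Λ) ℓ)
      ↔ thresholdStiffness K < Λ := by
  simp only [isMinOn_deo_iff]
  exact exists_isMinOn_gapSimplex_iff hK

/-- `K ≤ 2`: a positive optimum exists for EVERY `Λ > 0` (it is the uniform ladder; `Λ_c = 0`). [ours] -/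
theorem exists_isMinOn_gapSimplex_of_le_two (hK : 0 < K) (hK2 : K ≤ 2) (hΛ : 0 < Λ) :
    ∃ ℓ ∈ gapSimplex K Λ, IsMinOn (gapIndexCost K) (gapSimplex K Λ) ℓ :=
  exists_isMinOn_gapSimplex hK (by rwa [thresholdStiffness_of_le_two hK2])

/-- At or below the threshold no positive gap vector is index-optimal (the infimum over the positive simplex is not
attained). [ours] -/
theorem not_isMinOn_of_le_thresholdStiffness (hK : 0 < K) (hΛ : Λ ≤ thresholdStiffness K) {ℓ : ℕ → ℝ}
    (hℓ : ℓ ∈ gapSimplex K Λ) : ¬ IsMinOn (gapIndexCost K) (gapSimplex K Λ) ℓ := fun h =>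
  absurd hΛ (not_le.2 (thresholdStiffness_lt_of_isMinOn hℓ h hK))

/-- **THE COLLAPSE, QUANTIFIED: for `0 ≤ Λ ≤ Λ_c(K)` (`K ≥ 1`) every closed-simplex minimiser (one exists) HAS A
ZERO GAP** — optimising the model index `τ_int` at small total stiffness merges replicas. [ours] -/
theorem exists_gap_eq_zero_of_le_thresholdStiffness (hK : 0 < K) (hΛ : Λ ≤ thresholdStiffness K)
    {v : Fin K → ℝ} (hv : v ∈ closedGapSimplex K Λ) (hmin : IsMinOn (finIndexCost K) (closedGapSimplex K Λ) v) :
    ∃ i : Fin K, v i = 0 := by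
  by_contra h
  simp only [not_exists] at h
  have hpos : ∀ i, 0 < v i := fun i => lt_of_le_of_ne (hv.1 i) (Ne.symm (h i))
  have hb := isMinOn_gapSimplex_of_closed hv hmin hpos
  exact not_isMinOn_of_le_thresholdStiffness hK hΛ hb.1 hb.2

/-- For `K ≥ 3` the dichotomy is real: `Λ_c(K) > 0`, so SOME stiffness budgets collapse and others do not; e.g. with
`Λ = Λ_c(K)` itself the closed-simplex minimiser has a zero gap. [ours] -/
theorem exists_gap_eq_zero_at_thresholdStiffness (hK : 3 ≤ K) :
    ∃ v ∈ closedGapSimplex K (thresholdStiffness K),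
      IsMinOn (finIndexCost K) (closedGapSimplex K (thresholdStiffness K)) v ∧ ∃ i : Fin K, v i = 0 := by
  have hK0 : 0 < K := by omega
  obtain ⟨v, hv, hmin⟩ := exists_isMinOn_closedGapSimplex hK0 (thresholdStiffness_nonneg K)
  exact ⟨v, hv, hmin, exists_gap_eq_zero_of_le_thresholdStiffness hK0 le_rfl hv hmin⟩

end Main

end Summit.Ventures.LatticeQCDFlow.Scaling

end
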